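import Summits.QuantumFields.YangMills.Theorems.UnitScaleTiltProp7QTwSReality
import HarnessLib

/-!
# Route `UnitScaleTilt`, crux «MinimiserStabilityRegPr» (stmt-QuantumFields-19200, stub EX) ∕ (O″χ) B0 (stmt-QuantumFields-20520), node N06(d = 3), route (α) —
# LAYER 0, def-free: **THE QUADRATIC TERM `C⁽²⁾(U₀)` OF PRINT'S AVERAGING ([Balaban1985BackgroundPropagators] (3.14)) IS SYMMETRIC AND `𝔰𝔲(2)`-REAL AT `U₀ ∈ 𝔘_k(ε₀)`** — the second
# Fréchet derivative `D²(log U̿^{twS})(0)` of the re-based twisted log-chart of ✓`Prop7SymAvgTwSymDefs` (its first derivative is `QTwS U₀`; its second is the letter `avgHess` of the J-term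
# `T_J` of (3.127), brick L0b part 4) is Schwarz-symmetric and maps pairs of `𝔰𝔲(2)`-valued fields to `𝔰𝔲(2)`-valued block fields, hence on traceless fields
# `D²(log U̿)(0)[Xᴴ, Yᴴ] = −(D²(log U̿)(0)[X, Y])ᴴ` — the second-order twin of (Q-a) ✓`Prop7QTwSReality.QTwS_skewHermitian_traceless_of_regPr`

Cell `ym-inputs` (desk `pub/ym-inputs`, INPUT-LIST.md v10 §4 row p01 «J-term … rows later announce-first»).  THEOREMS ONLY (0 `def`, 0 `sorry`); `--supports stmt-QuantumFields-20520 --as helper`;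
count-neutral.  YM₃ on T³ is ladder rung R3, NOT the Clay problem; nothing here is a claim about a stub, a crux, d = 4 or the mass gap.

THE MATHEMATICS.  (§0, frame-free) If `f` is analytic on the ball `B(0, ρ)` of a complex normed space and maps `S ∩ B(0, ρ)` into a CLOSED real subspace `S′` for a real subspace `S`, then not
only `Df(0)(S) ⊆ S′` (✓`fderiv_apply_mem_of_mapsTo_of_ball`, p03∕★w4's road to (Q-a)) but also `D²f(0)[u, v] ∈ S′` for `u, v ∈ S`: at every `x ∈ S ∩ B(0, ρ)` the translate `y ↦ f(x + y) − f(x)`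
maps `S ∩ B(0, ρ − ‖x‖)` into `S′`, so `Df(x)v ∈ S′`; hence `x ↦ Df(x)v − Df(0)v` maps `S ∩ B(0, ρ)` into `S′` and its derivative at `0` along `u`, which is `D²f(0)[u, v]` (`HasFDerivAt.clm_apply`),
lies in `S′`.  (§1) At `U₀ ∈ 𝔘_k(ε₀)` in the windows `10⁹L²e ≤ 1`, `10¹²L³ε₀ ≤ 1` the log-chart is analytic on `B(0, e·η)` (W5 ✓`analyticOnNhd_logChartTwS`) and maps `𝔰𝔲(2)`-valued fields of
the ball to `𝔰𝔲(2)`-valued block fields (✓`logChartTwS_skewHermitian_of_ball` ∘ ✓`dbarTwS_mem_specialUnitaryUnits_of_skewHermitian`), so §0 applies with `S`, `S′` the skew-Hermitian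
traceless fields; Schwarz symmetry is Mathlib's `ContDiffAt.isSymmSndFDerivAt`.  (§2) A traceless `X` is `s₁ + i s₂` with `s₁ = ½(X − Xᴴ)`, `s₂ = −(i∕2)(X + Xᴴ)` in `S`; `ℂ`-bilinearity and
`(D²f[s, t])ᴴ = −D²f[s, t]` on `S × S` give `D²f[Xᴴ, Yᴴ] = −(D²f[X, Y])ᴴ` for traceless `X, Y`.

WHAT IS PROVED: §0 ★`fderiv_apply_mem_of_mapsTo_of_ball_at` (the first-order lemma at a base point `x ∈ S ∩ B`), ★★`fderiv_fderiv_apply_mem_of_mapsTo_of_ball` (second order); §1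
★★`fderiv_fderiv_logChartTwS_symm_of_regPr` (Schwarz), ★★`fderiv_fderiv_logChartTwS_skewHermitian_traceless_of_regPr` (`𝔰𝔲(2) × 𝔰𝔲(2) → 𝔰𝔲(2)`); §2 ★★★`fderiv_fderiv_logChartTwS_star_of_traceless`
(`D²(log U̿)(0)[Xᴴ, Yᴴ](c) = −(D²(log U̿)(0)[X, Y](c))ᴴ` for traceless `X, Y`, at `U₀ ∈ 𝔘_k(ε₀)`).
NOT HERE: the CENTRAL directions (`D²(log U̿)(0)[X, c·1] = 0` — centre-equivariance of the averaging tower at a general perturbation, the second-order twin of ★w5-20520's (Q-b)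
✓`QTwS_apply_smul_one_of_regPr`; displayed where consumed), and the J-term rows themselves (sibling `…DeltaOneT3JTermRows`).
HONEST SCOPE.  Calculus bookkeeping over landed analyticity ∕ reality facts of the chart of record; no estimate; nothing of print asserted; N06 NOT discharged; no stub closed.

References: T. Bałaban, CMP **99** (1985) 389–434 [Balaban1985BackgroundPropagators] ((3.13)–(3.14) p.393 «C_j(U, A) is an analytic function of A whose expansion begins with second order terms»,
(3.127) p.421); CMP **102** (1985) 277–309 [Balaban1985Variational] ((44) p.285, (51) p.286 «for A′ with values in 𝔤 …»).
-/

set_option autoImplicit false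

noncomputable section

open Metric Set Filter Topology
open scoped Matrix.Norms.L2Operator

namespace Summit.QuantumFields.YangMills.Theorems.Prop7QTwSHessianReality

open Literature.MathematicalPhysics.QuantumFieldTheory.Balaban1983to89
open Literature.MathematicalPhysics.QuantumFieldTheory.Balaban1983to89.T3ContinuumYM3Torus
open T3PrintedRegularMinimiser (RegPr)
open T3SectALandauChart (eta eta_pos)
open Summit.QuantumFields.YangMills.Theorems.Prop7SymAvgTwSym (dbarTwS logChartTwS QTwS logChartTwS_zero QTwS_def)
open Summit.QuantumFields.YangMills.Theorems.Prop7ChartRealityTwS (fderiv_apply_mem_of_mapsTo_of_ball logChartTwS_skewHermitian_of_ball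
  dbarTwS_mem_specialUnitaryUnits_of_skewHermitian)
open Summit.QuantumFields.YangMills.Theorems.Prop7CmapTwSymInputs (analyticOnNhd_logChartTwS)
open Summit.QuantumFields.YangMills.Theorems.Prop7ChartRealityKnitS (isClosed_skewHermitian_traceless)

/-! ## §0 Frame-free: first and second derivatives of a map sending `S ∩ B(0,ρ)` into a closed real subspace -/

section FrameFree

variable {E F : Type*} [NormedAddCommGroup E] [NormedSpace ℂ E] [NormedAddCommGroup F] [NormedSpace ℂ F]

/-- ★ **THE DERIVATIVE AT A POINT `x ∈ S ∩ B(0,ρ)` OF A MAP SENDING `S ∩ B(0,ρ)` INTO THE CLOSED `S′` SENDS `S` INTO `S′`** (translate ✓`fderiv_apply_mem_of_mapsTo_of_ball` to the base point `x`: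
`y ↦ f(x + y) − f(x)` maps `S ∩ B(0, ρ − ‖x‖)` into `S′`). [cite: Balaban1985Variational, (51) p.286; Balaban1985BackgroundPropagators, (3.14) p.393] -/
theorem fderiv_apply_mem_of_mapsTo_of_ball_at {f : E → F} {f' : E →L[ℂ] F} {x : E} (hf : HasFDerivAt f f' x)
    (S : Submodule ℝ E) (S' : Submodule ℝ F) (hS' : IsClosed (S' : Set F)) {ρ : ℝ} (hx : x ∈ S) (hxρ : ‖x‖ < ρ)
    (hmaps : ∀ y ∈ S, ‖y‖ < ρ → f y ∈ S') {v : E} (hv : v ∈ S) :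
    f' v ∈ S' := by
  have hg : HasFDerivAt (fun y => f (x + y) - f x) f' 0 := by
    have h1 : HasFDerivAt (fun y : E => x + y) (ContinuousLinearMap.id ℂ E) 0 := (hasFDerivAt_id (0 : E)).const_add x
    have h2 : HasFDerivAt f f' (x + 0) := by rw [add_zero]; exact hf
    have h3 := (h2.comp (0 : E) h1).sub_const (f x)
    rwa [ContinuousLinearMap.comp_id] at h3
  refine fderiv_apply_mem_of_mapsTo_of_ball hg (by rw [add_zero, sub_self]) S S' hS' (sub_pos.2 hxρ) (fun y hy hyρ => ?_) hv
  refine S'.sub_mem (hmaps _ (S.add_mem hx hy) ?_) (hmaps _ hx hxρ)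
  calc ‖x + y‖ ≤ ‖x‖ + ‖y‖ := norm_add_le _ _
    _ < ‖x‖ + (ρ - ‖x‖) := by linarith
    _ = ρ := by ring

/-- ★★ **THE SECOND DERIVATIVE AT `0` OF AN ANALYTIC MAP SENDING `S ∩ B(0,ρ)` INTO THE CLOSED `S′` SENDS `S × S` INTO `S′`**: `D²f(0)[u, v] ∈ S′` for `u, v ∈ S` (the first-order lemma at every
`x ∈ S ∩ B(0,ρ)` makes `x ↦ Df(x)v − Df(0)v` a map `S ∩ B(0,ρ) → S′`; differentiate it at `0` along `u`). [cite: Balaban1985BackgroundPropagators, (3.14) p.393; Balaban1985Variational, (51) p.286] -/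
theorem fderiv_fderiv_apply_mem_of_mapsTo_of_ball [CompleteSpace F] {f : E → F} {ρ : ℝ} (hρ : 0 < ρ) (hf : AnalyticOnNhd ℂ f (ball (0 : E) ρ))
    (S : Submodule ℝ E) (S' : Submodule ℝ F) (hS' : IsClosed (S' : Set F))
    (hmaps : ∀ y ∈ S, ‖y‖ < ρ → f y ∈ S') {u v : E} (hu : u ∈ S) (hv : v ∈ S) :
    fderiv ℂ (fun x => fderiv ℂ f x) 0 u v ∈ S' := by
  -- `x ↦ Df(x)` is analytic on the ball, in particular differentiable at `0`
  have hc : HasFDerivAt (fun x => fderiv ℂ f x) (fderiv ℂ (fun x => fderiv ℂ f x) 0) 0 :=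
    ((hf.fderiv) 0 (mem_ball_self hρ)).differentiableAt.hasFDerivAt
  -- `x ↦ Df(x)v − Df(0)v` has derivative `u ↦ D²f(0)[u, v]` at `0`
  have hg : HasFDerivAt (fun x => fderiv ℂ f x v - fderiv ℂ f 0 v) ((fderiv ℂ (fun x => fderiv ℂ f x) 0).flip v) 0 := by
    have h1 := (hc.clm_apply (hasFDerivAt_const v (0 : E))).sub_const (fderiv ℂ f 0 v)
    simpa only [ContinuousLinearMap.comp_zero, zero_add] using h1
  have key := fderiv_apply_mem_of_mapsTo_of_ball hg (by rw [sub_self]) S S' hS' hρ (fun y hy hyρ => ?_) hu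
  · simpa only [ContinuousLinearMap.flip_apply] using key
  -- the first-order lemma at the base points `y` and `0`
  have hDy : fderiv ℂ f y v ∈ S' :=
    fderiv_apply_mem_of_mapsTo_of_ball_at ((hf y (mem_ball_zero_iff.2 hyρ)).differentiableAt.hasFDerivAt) S S' hS' hy hyρ hmaps hv
  have hD0 : fderiv ℂ f 0 v ∈ S' :=
    fderiv_apply_mem_of_mapsTo_of_ball_at ((hf 0 (mem_ball_self hρ)).differentiableAt.hasFDerivAt) S S' hS' S.zero_mem (by rw [norm_zero]; exact hρ) hmaps hv
  exact S'.sub_mem hDy hD0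

/-- **SCHWARZ SYMMETRY AT AN INTERIOR POINT OF ANALYTICITY**: `D²f(0)[u, v] = D²f(0)[v, u]` (Mathlib's `ContDiffAt.isSymmSndFDerivAt`). [folklore] -/
theorem fderiv_fderiv_symm_of_analyticOnNhd [CompleteSpace F] {f : E → F} {ρ : ℝ} (hρ : 0 < ρ) (hf : AnalyticOnNhd ℂ f (ball (0 : E) ρ)) (u v : E) :
    fderiv ℂ (fun x => fderiv ℂ f x) 0 u v = fderiv ℂ (fun x => fderiv ℂ f x) 0 v u :=
  ((hf 0 (mem_ball_self hρ)).contDiffAt.isSymmSndFDerivAt (n := ⊤) (by simp)) u v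

end FrameFree

/-! ## §1 At `U₀ ∈ 𝔘_k(ε₀)`: the averaging Hessian is symmetric and `𝔰𝔲(2)`-real -/

variable (F : T3Family) {n K : ℕ} (h : n ≤ K)

/-- ★★ **SCHWARZ SYMMETRY OF PRINT'S `C⁽²⁾(U₀)`**: `D²(log U̿^{twS})(0)[X, Y] = D²(log U̿^{twS})(0)[Y, X]` at `U₀ ∈ 𝔘_k(ε₀)` in the windows (analyticity on the ball `e·η`, W5).
[cite: Balaban1985BackgroundPropagators, (3.14) p.393; Balaban1985Averaging, Prop. 4 p.38] -/
theorem fderiv_fderiv_logChartTwS_symm_of_regPr [Fact (0 < (F.L : ℝ))] [Fact (0 < ((F.L : ℝ)⁻¹) ^ (K - n))]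
    {ε₀ e : ℝ} (hε₀ : 0 < ε₀) (he : 0 < e) (hWe : 10 ^ 9 * (F.L : ℝ) ^ 2 * e ≤ 1) (hWε : 10 ^ 12 * (F.L : ℝ) ^ 3 * ε₀ ≤ 1)
    (U₀ : GaugeField (F.P K) 0 (Matrix.specialUnitaryGroup (Fin 2) ℂ)) (hreg : RegPr F n K ε₀ U₀) (X Y : PBond (F.P K) 0 → Matrix (Fin 2) (Fin 2) ℂ) :
    fderiv ℂ (fun A => fderiv ℂ (logChartTwS F n K h U₀) A) 0 X Y = fderiv ℂ (fun A => fderiv ℂ (logChartTwS F n K h U₀) A) 0 Y X :=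
  fderiv_fderiv_symm_of_analyticOnNhd (mul_pos he (eta_pos F n K)) (analyticOnNhd_logChartTwS F h hε₀ he hWe hWε U₀ hreg) X Y

/-- ★★ **(Q-a)⁽²⁾: `C⁽²⁾(U₀)` MAPS PAIRS OF `𝔰𝔲(2)`-VALUED FINE FIELDS TO `𝔰𝔲(2)`-VALUED BLOCK FIELDS** at `U₀ ∈ 𝔘_k(ε₀)` in the windows `10⁹L²e ≤ 1`, `10¹²L³ε₀ ≤ 1` — §0 at the log-chart, which
is analytic on `B(0, e·η)` (W5) and maps the `𝔰𝔲(2)`-valued fields of the ball to `𝔰𝔲(2)`-valued block fields (`SU(2)`-valued averages). [cite: Balaban1985BackgroundPropagators, (3.13)–(3.14) p.393; Balaban1985Variational, (51) p.286] -/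
theorem fderiv_fderiv_logChartTwS_skewHermitian_traceless_of_regPr [Fact (0 < (F.L : ℝ))] [Fact (0 < ((F.L : ℝ)⁻¹) ^ (K - n))]
    {ε₀ e : ℝ} (hε₀ : 0 < ε₀) (he : 0 < e) (hWe : 10 ^ 9 * (F.L : ℝ) ^ 2 * e ≤ 1) (hWε : 10 ^ 12 * (F.L : ℝ) ^ 3 * ε₀ ≤ 1)
    (U₀ : GaugeField (F.P K) 0 (Matrix.specialUnitaryGroup (Fin 2) ℂ)) (hreg : RegPr F n K ε₀ U₀)
    (X Y : PBond (F.P K) 0 → Matrix (Fin 2) (Fin 2) ℂ) (hX : ∀ b, star (X b) = -X b ∧ (X b).trace = 0) (hY : ∀ b, star (Y b) = -Y b ∧ (Y b).trace = 0) (c : PBond (F.P n) 0) :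
    star (fderiv ℂ (fun A => fderiv ℂ (logChartTwS F n K h U₀) A) 0 X Y c) = -fderiv ℂ (fun A => fderiv ℂ (logChartTwS F n K h U₀) A) 0 X Y c ∧
      (fderiv ℂ (fun A => fderiv ℂ (logChartTwS F n K h U₀) A) 0 X Y c).trace = 0 := by
  -- the real subspaces of skew-Hermitian traceless fields (fine) and block fields (coarse)
  let S : Submodule ℝ (PBond (F.P K) 0 → Matrix (Fin 2) (Fin 2) ℂ) :=
    { carrier := {A | ∀ b', star (A b') = -A b' ∧ (A b').trace = 0}
      add_mem' := fun {A B} hA hB b' => by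
        refine ⟨?_, ?_⟩
        · rw [Pi.add_apply, star_add, (hA b').1, (hB b').1, neg_add]
        · rw [Pi.add_apply, Matrix.trace_add, (hA b').2, (hB b').2, add_zero]
      zero_mem' := fun b' => by simp
      smul_mem' := fun r A hA b' => by
        refine ⟨?_, ?_⟩
        · rw [Pi.smul_apply, star_smul, star_trivial, (hA b').1, smul_neg]
        · rw [Pi.smul_apply, Matrix.trace_smul, (hA b').2, smul_zero] }
  let S' : Submodule ℝ (PBond (F.P n) 0 → Matrix (Fin 2) (Fin 2) ℂ) :=
    { carrier := {Y | ∀ c, star (Y c) = -Y c ∧ (Y c).trace = 0}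
      add_mem' := fun {A B} hA hB c => by
        refine ⟨?_, ?_⟩
        · rw [Pi.add_apply, star_add, (hA c).1, (hB c).1, neg_add]
        · rw [Pi.add_apply, Matrix.trace_add, (hA c).2, (hB c).2, add_zero]
      zero_mem' := fun c => by simp
      smul_mem' := fun r A hA c => by
        refine ⟨?_, ?_⟩
        · rw [Pi.smul_apply, star_smul, star_trivial, (hA c).1, smul_neg]
        · rw [Pi.smul_apply, Matrix.trace_smul, (hA c).2, smul_zero] }
  have hS'c : IsClosed (S' : Set (PBond (F.P n) 0 → Matrix (Fin 2) (Fin 2) ℂ)) := isClosed_skewHermitian_traceless (PBond (F.P n) 0)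
  have hρ : 0 < e * eta F n K := mul_pos he (eta_pos F n K)
  -- reality of the chart on the ball `‖y‖ < e·η` (SU(2)-valued averages of SU(2) data)
  have hmaps : ∀ y ∈ S, ‖y‖ < e * eta F n K → logChartTwS F n K h U₀ y ∈ S' := fun y hy hyR c' =>
    logChartTwS_skewHermitian_of_ball F h hε₀ he.le hWe hWε U₀ hreg y (fun b => (norm_le_pi_norm y b).trans hyR.le)
      (fun c'' => dbarTwS_mem_specialUnitaryUnits_of_skewHermitian F h hε₀ he.le hWe hWε U₀ hreg y hy
        (fun b => (norm_le_pi_norm y b).trans hyR.le) c'') c'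
  have key : fderiv ℂ (fun A => fderiv ℂ (logChartTwS F n K h U₀) A) 0 X Y ∈ S' :=
    fderiv_fderiv_apply_mem_of_mapsTo_of_ball hρ (analyticOnNhd_logChartTwS F h hε₀ he hWe hWε U₀ hreg) S S' hS'c hmaps (u := X) (v := Y) hX hY
  exact key c

/-! ## §2 On traceless fields: `C⁽²⁾[Xᴴ, Yᴴ] = −(C⁽²⁾[X, Y])ᴴ` -/

/-- Algebra: a traceless `2 × 2` field is `s₁ + i·s₂` with `s₁ = ½(X − Xᴴ)`, `s₂ = −(i∕2)(X + Xᴴ)` skew-Hermitian traceless, and `Xᴴ = −s₁ + i·s₂`. [folklore] -/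
theorem traceless_decomp (X : PBond (F.P K) 0 → Matrix (Fin 2) (Fin 2) ℂ) (hX : ∀ b, (X b).trace = 0) :
    (∀ b, star (((2 : ℂ)⁻¹ • (X - star X)) b) = -((2 : ℂ)⁻¹ • (X - star X)) b ∧ (((2 : ℂ)⁻¹ • (X - star X)) b).trace = 0) ∧
    (∀ b, star (((-(Complex.I / 2)) • (X + star X)) b) = -((-(Complex.I / 2)) • (X + star X)) b ∧ (((-(Complex.I / 2)) • (X + star X)) b).trace = 0) ∧
    X = (2 : ℂ)⁻¹ • (X - star X) + Complex.I • ((-(Complex.I / 2)) • (X + star X)) ∧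
    star X = -((2 : ℂ)⁻¹ • (X - star X)) + Complex.I • ((-(Complex.I / 2)) • (X + star X)) := by
  have htr : ∀ b, (star X b).trace = 0 := fun b => by
    rw [Pi.star_apply, Matrix.star_eq_conjTranspose, Matrix.trace_conjTranspose, hX b, star_zero]
  refine ⟨fun b => ⟨?_, ?_⟩, fun b => ⟨?_, ?_⟩, ?_, ?_⟩
  · rw [Pi.smul_apply, Pi.sub_apply, star_smul, star_sub, Pi.star_apply, star_star, Complex.star_def, map_inv₀, map_ofNat, ← smul_neg, neg_sub]
  · rw [Pi.smul_apply, Pi.sub_apply, Matrix.trace_smul, Matrix.trace_sub, hX b, htr b, sub_zero, smul_zero]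
  · rw [Pi.smul_apply, Pi.add_apply, star_smul, star_add, Pi.star_apply, star_star, star_neg, Complex.star_def, map_div₀, Complex.conj_I, map_ofNat, add_comm (star (X b))]
    simp only [neg_div, neg_smul, neg_neg]
  · rw [Pi.smul_apply, Pi.add_apply, Matrix.trace_smul, Matrix.trace_add, hX b, htr b, add_zero, smul_zero]
  · rw [smul_smul, show Complex.I * -(Complex.I / 2) = (2 : ℂ)⁻¹ by rw [mul_neg, mul_div_assoc', Complex.I_mul_I]; norm_num, ← smul_add]
    rw [sub_add_add_cancel, ← two_smul ℂ X, smul_smul, inv_mul_cancel₀ (two_ne_zero), one_smul]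
  · rw [smul_smul, show Complex.I * -(Complex.I / 2) = (2 : ℂ)⁻¹ by rw [mul_neg, mul_div_assoc', Complex.I_mul_I]; norm_num, ← smul_neg, ← smul_add,
      show -(X - star X) + (X + star X) = (2 : ℂ) • star X by rw [two_smul]; abel, smul_smul, inv_mul_cancel₀ (two_ne_zero), one_smul]

/-- ★★★ **`C⁽²⁾(U₀)` IS REAL ON THE TRACELESS SECTOR: `D²(log U̿^{twS})(0)[Xᴴ, Yᴴ](c) = −(D²(log U̿^{twS})(0)[X, Y](c))ᴴ`** for traceless `X, Y` at `U₀ ∈ 𝔘_k(ε₀)` in the windows — (Q-a)⁽²⁾ + `ℂ`-bilinearity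
through `X = s₁ + i s₂`, `Xᴴ = −s₁ + i s₂`. [cite: Balaban1985BackgroundPropagators, (3.14) p.393; Balaban1985Variational, (51) p.286] -/
theorem fderiv_fderiv_logChartTwS_star_of_traceless [Fact (0 < (F.L : ℝ))] [Fact (0 < ((F.L : ℝ)⁻¹) ^ (K - n))]
    {ε₀ e : ℝ} (hε₀ : 0 < ε₀) (he : 0 < e) (hWe : 10 ^ 9 * (F.L : ℝ) ^ 2 * e ≤ 1) (hWε : 10 ^ 12 * (F.L : ℝ) ^ 3 * ε₀ ≤ 1)
    (U₀ : GaugeField (F.P K) 0 (Matrix.specialUnitaryGroup (Fin 2) ℂ)) (hreg : RegPr F n K ε₀ U₀)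
    (X Y : PBond (F.P K) 0 → Matrix (Fin 2) (Fin 2) ℂ) (hX : ∀ b, (X b).trace = 0) (hY : ∀ b, (Y b).trace = 0) (c : PBond (F.P n) 0) :
    fderiv ℂ (fun A => fderiv ℂ (logChartTwS F n K h U₀) A) 0 (star X) (star Y) c = -star (fderiv ℂ (fun A => fderiv ℂ (logChartTwS F n K h U₀) A) 0 X Y c) := by
  set B := fderiv ℂ (fun A => fderiv ℂ (logChartTwS F n K h U₀) A) 0 with hB_def
  obtain ⟨hs₁, hs₂, hXd, hXs⟩ := traceless_decomp F X hX
  obtain ⟨ht₁, ht₂, hYd, hYs⟩ := traceless_decomp F Y hY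
  set s₁ := (2 : ℂ)⁻¹ • (X - star X)
  set s₂ := (-(Complex.I / 2)) • (X + star X)
  set t₁ := (2 : ℂ)⁻¹ • (Y - star Y)
  set t₂ := (-(Complex.I / 2)) • (Y + star Y)
  -- the four real blocks are skew-Hermitian
  have r11 := (fderiv_fderiv_logChartTwS_skewHermitian_traceless_of_regPr F h hε₀ he hWe hWε U₀ hreg s₁ t₁ hs₁ ht₁ c).1
  have r12 := (fderiv_fderiv_logChartTwS_skewHermitian_traceless_of_regPr F h hε₀ he hWe hWε U₀ hreg s₁ t₂ hs₁ ht₂ c).1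
  have r21 := (fderiv_fderiv_logChartTwS_skewHermitian_traceless_of_regPr F h hε₀ he hWe hWε U₀ hreg s₂ t₁ hs₂ ht₁ c).1
  have r22 := (fderiv_fderiv_logChartTwS_skewHermitian_traceless_of_regPr F h hε₀ he hWe hWε U₀ hreg s₂ t₂ hs₂ ht₂ c).1
  rw [← hB_def] at r11 r12 r21 r22
  -- expand both sides by bilinearity
  have lhs : B (star X) (star Y) c = B s₁ t₁ c - Complex.I • B s₁ t₂ c - Complex.I • B s₂ t₁ c - B s₂ t₂ c := by
    rw [hXs, hYs]
    simp only [map_add, map_neg, map_smul, add_apply, neg_apply, smul_apply, Pi.add_apply, Pi.neg_apply,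
      Pi.smul_apply, smul_add, smul_neg, smul_smul, Complex.I_mul_I, neg_smul, one_smul]
    abel
  have rhs : B X Y c = B s₁ t₁ c + Complex.I • B s₁ t₂ c + Complex.I • B s₂ t₁ c - B s₂ t₂ c := by
    rw [hXd, hYd]
    simp only [map_add, map_smul, add_apply, smul_apply, Pi.add_apply, Pi.neg_apply,
      Pi.smul_apply, smul_add, smul_smul, Complex.I_mul_I, neg_smul, one_smul]
    abel
  rw [lhs, rhs, star_sub, star_add, star_add, star_smul, star_smul, r11, r12, r21, r22, Complex.star_def, Complex.conj_I]
  simp only [smul_neg, neg_smul, neg_neg, neg_sub]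
  abel

end Summit.QuantumFields.YangMills.Theorems.Prop7QTwSHessianReality

end
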